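import Literature.NumberTheory.LFunctions.Zhang2022.DetectorDictShiftCircle

/-!
# Zhang (2022), programme F-S3 (cell landau-siegel §E, row S-E-p6-3, kernel leaf [K7] Part 3): the `H¹` LIFT of the
# shift dictionary slot — `DictS ≥ 0` on kinked profiles ⇒ on `H¹` (density of `C¹` profiles), and the `H¹` interface
# form `Det.dictShiftPSD_of_bridges`

Y. Zhang, *Discrete mean estimates and the Landau–Siegel zero*, arXiv:2211.02515v1 [Zhang2022LandauSiegel] —
an unrefereed manuscript under adjudication. **WHAT THIS IS NOT: not a claim about Theorems 1–2 of
arXiv:2211.02515, about Landau–Siegel zeros, about a repaired `Margin232`, or about Parity. The programme SEARCHES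
and TYPES; no claim about Landau–Siegel zeros, Theorems 1–2 of arXiv:2211.02515 or a repaired Margin232 until a
kernel theorem says so.**

Companion of `DetectorDictShiftCircle` (K7 Parts 1–2: the general-apex closed form `dictShift_eq_bulk_add_jets` and the
circle assembly `dictShift_nonneg_of_bridge` on KINKED profiles). The §E glued row `Repair.familyDetGlued` displays the
slot `Det.DictShiftPSD b` on `H¹` profiles (`DetectorDictFormCS`); this file closes the gap kinked → `H¹` exactly as
`MainTermFormH1.mainTermForm_nonneg_of_isH1` does for (4.1): `L²`-density of continuous functions gives `C¹` approximants
`Gₙ = g(0) + ∫₀ hₙ` with `hₙ → g′` in `L²`, `Gₙ → g` and `∫₀Gₙ → ∫₀g` uniformly, `Gₙ(0) = g(0)`, `Gₙ(1) → g(1)`, and every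
term of the dictionary `Det.DictS R W′ c₀` (six-moment bulk + three apex atoms) passes to the limit.

* `dictS_nonneg_of_isH1_of_kinked` (any recipe `R`, any glue pair): `(∀ kinked G, 0 ≤ DictS(G)) → ∀ H¹ g, 0 ≤ DictS(g)`;
* `dictShiftPSD_of_kinked : (∀ kinked G, 0 ≤ DictShift b G G′) → Det.DictShiftPSD b`;
* `dictShiftPSD_of_bridges : SignAdmissible b → (a unit bridge for every jet datum, K2″ shape) → Det.DictShiftPSD b`
  — so the two-point identity K2″ (`DetectorTwoPointIdentity`, ls-barrier-num g3) discharges the slot of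
  `Repair.familyDetGlued` for every sign-admissible `b` by a short instantiation (Part 4, appended on its ACCEPT).

Elementary real analysis ([folklore] limit bookkeeping); 0 named facts; 0 sorries; standard axioms.
References: arXiv:2211.02515v1 §4 (4.1); §2 (2.18)–(2.19); Prop. 7.1 p.44 with (7.2), (8.11)–(8.23); §18 (18.1).
[cite: Zhang2022LandauSiegel, §§2, 4, 7–8, 18]
-/

noncomputable section

open Complex Real ComplexConjugate Set MeasureTheory intervalIntegral Topology Filter

namespace Literature.NumberTheory.LFunctions.Zhang2022

namespace Det

open Repair

variable {b : Fin 3 → ℝ}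

/-- `∫₀¹ G·conj G′ = conj ∫₀¹ G′·conj G`. [folklore] -/
private theorem integral_mul_conj_eq_conj_swap (G G' : ℝ → ℂ) :
    (∫ x in (0:ℝ)..1, G x * conj (G' x)) = conj (∫ x in (0:ℝ)..1, G' x * conj (G x)) := by
  have : conj (∫ x in (0:ℝ)..1, G' x * conj (G x)) = ∫ x in (0:ℝ)..1, conj (G' x * conj (G x)) := by
    simp only [intervalIntegral, map_sub, integral_conj]
  rw [this]
  exact intervalIntegral.integral_congr fun x _ => by simp [mul_comm]

/-! ### The `H¹` lift (density of `C¹` profiles, `MainTermFormH1` template): kinked ⇒ `H¹` -/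

section Density

variable {R : DetRecipe} {Wp : Fin 3 → ℂ} {c0 : ℂ} {g g' : ℝ → ℂ}

/-- A `C¹` profile with `L²` derivative companion is kinked. [folklore] -/
private theorem kinked_of_isC1 {G H : ℝ → ℂ} (hG : IsC1OnUnitInterval G H)
    (hm : MemLp H 2 (volume.restrict (Ioc (0:ℝ) 1))) : KinkedProfile G H :=
  ⟨hG.cont, fun x hx => (hG.hasDeriv x hx).hasDerivWithinAt, hm⟩

/-- **The dictionary passes to the limit along the `C¹` approximants of an `H¹` profile**: with `Gₙ = g(0) + ∫₀ hₙ`,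
`hₙ → g′` in `L²` continuous, `DictS R W′ c₀ (Gₙ, hₙ) → DictS R W′ c₀ (g, g′)` — hence **non-negativity of the
dictionary on kinked profiles implies non-negativity on `H¹`** (every term of `DictS` is continuous along the
approximation; the proof is `mainTermForm_nonneg_of_isH1`'s, term by term). [cite: Zhang2022LandauSiegel, §4 (4.1); §2 (2.18)–(2.19)] -/
theorem dictS_nonneg_of_isH1_of_kinked (R : DetRecipe) (Wp : Fin 3 → ℂ) (c0 : ℂ)
    (hk : ∀ G H : ℝ → ℂ, KinkedProfile G H → 0 ≤ DictS R Wp c0 G H) (hg : IsH1OnUnitInterval g g') :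
    0 ≤ DictS R Wp c0 g g' := by
  have h0 : (0:ℝ) ∈ Icc (0:ℝ) 1 := left_mem_Icc.2 zero_le_one
  have h1 : (1:ℝ) ∈ Icc (0:ℝ) 1 := right_mem_Icc.2 zero_le_one
  -- data about `g`
  have hgc : ContinuousOn g (Icc 0 1) := hg.continuousOn
  have hgi : IntervalIntegrable g volume 0 1 := hgc.intervalIntegrable_of_Icc zero_le_one
  have hg'i : IntervalIntegrable g' volume 0 1 := hg.intervalIntegrable
  obtain ⟨B₀, hB₀⟩ := isCompact_Icc.exists_bound_of_continuousOn hgc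
  have hB : ∀ x ∈ Icc (0:ℝ) 1, ‖g x‖ ≤ max B₀ 0 := fun x hx => (hB₀ x hx).trans (le_max_left _ _)
  have hB0 : 0 ≤ max B₀ 0 := le_max_right _ _
  -- the approximants `hₙ → g′` in `L²`
  have hex : ∀ n : ℕ, ∃ h : ℝ → ℂ, Continuous h ∧ MemLp h 2 (volume.restrict (Ioc (0:ℝ) 1)) ∧
      ∫ x in (0:ℝ)..1, ‖h x - g' x‖ ^ 2 ≤ 1 / ((n:ℝ) + 1) :=
    fun n => hg.exists_continuous_approx (by positivity)
  choose h hc hm he using hex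
  obtain ⟨e, he_def⟩ : ∃ e : ℕ → ℝ, ∀ n, e n = ∫ x in (0:ℝ)..1, ‖h n x - g' x‖ ^ 2 := ⟨_, fun _ => rfl⟩
  obtain ⟨d, hd_def⟩ : ∃ d : ℕ → ℝ, ∀ n, d n = ∫ x in (0:ℝ)..1, ‖h n x - g' x‖ := ⟨_, fun _ => rfl⟩
  have hhi : ∀ n, IntervalIntegrable (h n) volume 0 1 := fun n => (hc n).intervalIntegrable 0 1
  have hdi : ∀ n, IntervalIntegrable (fun x => h n x - g' x) volume 0 1 := fun n => (hhi n).sub hg'i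
  have hei : ∀ n, IntervalIntegrable (fun x => ‖h n x - g' x‖ ^ 2) volume 0 1 := by
    intro n
    rw [intervalIntegrable_iff, uIoc_of_le zero_le_one]
    have hm2 : MemLp (fun x => h n x - g' x) 2 (volume.restrict (Ioc (0:ℝ) 1)) := (hm n).sub hg.memLp
    exact (memLp_two_iff_integrable_sq_norm hm2.1).1 hm2
  have he0 : ∀ n, 0 ≤ e n := fun n => by
    rw [he_def]; exact intervalIntegral.integral_nonneg zero_le_one fun x _ => sq_nonneg _
  have hd0 : ∀ n, 0 ≤ d n := fun n => by
    rw [hd_def]; exact intervalIntegral.integral_nonneg zero_le_one fun x _ => norm_nonneg _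
  have he_t : Tendsto e atTop (𝓝 0) :=
    squeeze_zero he0 (fun n => (he_def n).le.trans (he n)) tendsto_one_div_add_atTop_nhds_zero_nat
  have hsqrt_t : Tendsto (fun n => Real.sqrt (e n)) atTop (𝓝 0) := by
    have := (Real.continuous_sqrt.tendsto 0).comp he_t
    rw [Real.sqrt_zero] at this
    exact this
  have hd_le : ∀ n, d n ≤ Real.sqrt (e n) := fun n => by
    rw [Real.le_sqrt (hd0 n) (he0 n), hd_def, he_def]
    exact sq_integral_norm_le_unit (hdi n) (hei n)
  have hd_t : Tendsto d atTop (𝓝 0) := squeeze_zero hd0 hd_le hsqrt_t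
  -- the `C¹` approximants `Gₙ = g(0) + ∫₀ hₙ → g` uniformly
  obtain ⟨G, hG_def⟩ : ∃ G : ℕ → ℝ → ℂ, ∀ n, G n = fun y => g 0 + ∫ t in (0:ℝ)..y, h n t := ⟨_, fun _ => rfl⟩
  have hGC1 : ∀ n, IsC1OnUnitInterval (G n) (h n) := fun n => by
    rw [hG_def]; exact isC1_const_add_primitive (hc n) (g 0)
  have hGc : ∀ n, ContinuousOn (G n) (Icc 0 1) := fun n => (hGC1 n).cont
  have hGi : ∀ n, IntervalIntegrable (G n) volume 0 1 := fun n => (hGc n).intervalIntegrable_of_Icc zero_le_one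
  have hG0 : ∀ n, G n 0 = g 0 := fun n => by simp [hG_def]
  have hGg : ∀ n, ∀ y ∈ Icc (0:ℝ) 1, ‖G n y - g y‖ ≤ d n := fun n y hy => by
    rw [hG_def, hd_def]; exact norm_primitive_sub_le hg (hc n) hy
  have hGg1 : ∀ n, ∫ x in (0:ℝ)..1, ‖G n x - g x‖ ≤ d n := fun n => by
    calc ∫ x in (0:ℝ)..1, ‖G n x - g x‖ ≤ ∫ x in (0:ℝ)..1, d n :=
          intervalIntegral.integral_mono_on zero_le_one ((hGi n).sub hgi).norm intervalIntegrable_const (hGg n)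
      _ = d n := by simp
  -- the primitives `Sₙ = ∫₀ Gₙ → S = ∫₀ g` uniformly
  have hSc : ContinuousOn (fun x => ∫ t in (0:ℝ)..x, g t) (Icc 0 1) := continuousOn_primitive_unit hgc
  have hSnc : ∀ n, ContinuousOn (fun x => ∫ t in (0:ℝ)..x, G n t) (Icc 0 1) :=
    fun n => continuousOn_primitive_unit (hGc n)
  have hSB : ∀ x ∈ Icc (0:ℝ) 1, ‖∫ t in (0:ℝ)..x, g t‖ ≤ max B₀ 0 :=
    fun x hx => norm_integral_le_of_le_unit hB0 hB hx
  have hSnS : ∀ n, ∀ x ∈ Icc (0:ℝ) 1, ‖(∫ t in (0:ℝ)..x, G n t) - ∫ t in (0:ℝ)..x, g t‖ ≤ d n := fun n x hx => by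
    rw [← intervalIntegral.integral_sub (intervalIntegrable_mono_unit (hGi n) hx) (intervalIntegrable_mono_unit hgi hx)]
    exact norm_integral_le_of_le_unit (hd0 n) (hGg n) hx
  -- bound for `Gₙ` (uniformly close to the bounded `g`)
  have hGB : ∀ n, ∀ x ∈ Icc (0:ℝ) 1, ‖G n x‖ ≤ max B₀ 0 + d n := fun n x hx => by
    calc ‖G n x‖ = ‖g x + (G n x - g x)‖ := by rw [add_sub_cancel]
      _ ≤ ‖g x‖ + ‖G n x - g x‖ := norm_add_le _ _
      _ ≤ max B₀ 0 + d n := add_le_add (hB x hx) (hGg n x hx)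
  -- the limits
  have L1 : Tendsto (fun n => ∫ x in (0:ℝ)..1, ‖h n x‖ ^ 2) atTop (𝓝 (∫ x in (0:ℝ)..1, ‖g' x‖ ^ 2)) := by
    have hN0 : 0 ≤ ∫ x in (0:ℝ)..1, ‖g' x‖ ^ 2 := intervalIntegral.integral_nonneg zero_le_one fun x _ => sq_nonneg _
    obtain ⟨t, ht_def⟩ : ∃ t : ℕ → ℝ, ∀ n, t n = Real.sqrt (e n) + 1 / ((n:ℝ) + 1) := ⟨_, fun _ => rfl⟩
    have ht0 : ∀ n, 0 < t n := fun n => by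
      rw [ht_def]; exact add_pos_of_nonneg_of_pos (Real.sqrt_nonneg _) (by positivity)
    have ht_t : Tendsto t atTop (𝓝 0) := by
      have := hsqrt_t.add (tendsto_one_div_add_atTop_nhds_zero_nat (𝕜 := ℝ))
      rw [add_zero] at this
      exact this.congr fun n => (ht_def n).symm
    have hh2i : ∀ n, IntervalIntegrable (fun x => ‖h n x‖ ^ 2) volume 0 1 :=
      fun n => ((hc n).norm.pow 2).intervalIntegrable 0 1
    have hbd : Tendsto (fun n => e n + Real.sqrt (e n) + t n * ∫ x in (0:ℝ)..1, ‖g' x‖ ^ 2) atTop (𝓝 0) := by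
      simpa using (he_t.add hsqrt_t).add (ht_t.mul (tendsto_const_nhds (x := ∫ x in (0:ℝ)..1, ‖g' x‖ ^ 2)))
    rw [tendsto_iff_norm_sub_tendsto_zero]
    refine squeeze_zero (fun n => norm_nonneg _) (fun n => ?_) hbd
    rw [← intervalIntegral.integral_sub (hh2i n) hg.intervalIntegrable_sq]
    have hpt : ∀ x ∈ Icc (0:ℝ) 1, ‖‖h n x‖ ^ 2 - ‖g' x‖ ^ 2‖
        ≤ (1 + 1 / t n) * ‖h n x - g' x‖ ^ 2 + t n * ‖g' x‖ ^ 2 := by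
      intro x _
      have hab : |‖h n x‖ - ‖g' x‖| ≤ ‖h n x - g' x‖ := abs_norm_sub_norm_le _ _
      have key : |‖h n x‖ ^ 2 - ‖g' x‖ ^ 2| ≤ ‖h n x - g' x‖ ^ 2 + 2 * (‖h n x - g' x‖ * ‖g' x‖) := by
        rw [sq_sub_sq, abs_mul, abs_of_nonneg (by positivity : 0 ≤ ‖h n x‖ + ‖g' x‖)]
        calc (‖h n x‖ + ‖g' x‖) * |‖h n x‖ - ‖g' x‖|
            ≤ (‖h n x - g' x‖ + 2 * ‖g' x‖) * ‖h n x - g' x‖ := by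
              refine mul_le_mul ?_ hab (abs_nonneg _) (by positivity)
              calc ‖h n x‖ + ‖g' x‖ = ‖(h n x - g' x) + g' x‖ + ‖g' x‖ := by rw [sub_add_cancel]
                _ ≤ (‖h n x - g' x‖ + ‖g' x‖) + ‖g' x‖ := by gcongr; exact norm_add_le _ _
                _ = ‖h n x - g' x‖ + 2 * ‖g' x‖ := by ring
          _ = _ := by ring
      have amgm : 2 * (‖h n x - g' x‖ * ‖g' x‖) ≤ ‖h n x - g' x‖ ^ 2 / t n + t n * ‖g' x‖ ^ 2 := by
        have ht := ht0 n
        rw [div_add' _ _ _ ht.ne', le_div_iff₀ ht]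
        nlinarith [sq_nonneg (‖h n x - g' x‖ - t n * ‖g' x‖)]
      rw [Real.norm_eq_abs]
      calc _ ≤ _ := key
        _ ≤ ‖h n x - g' x‖ ^ 2 + (‖h n x - g' x‖ ^ 2 / t n + t n * ‖g' x‖ ^ 2) := by linarith
        _ = (1 + 1 / t n) * ‖h n x - g' x‖ ^ 2 + t n * ‖g' x‖ ^ 2 := by ring
    have i1 : IntervalIntegrable (fun x => (1 + 1 / t n) * ‖h n x - g' x‖ ^ 2 + t n * ‖g' x‖ ^ 2) volume 0 1 :=
      ((hei n).const_mul _).add (hg.intervalIntegrable_sq.const_mul _)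
    calc ‖∫ x in (0:ℝ)..1, (‖h n x‖ ^ 2 - ‖g' x‖ ^ 2)‖
        ≤ ∫ x in (0:ℝ)..1, ((1 + 1 / t n) * ‖h n x - g' x‖ ^ 2 + t n * ‖g' x‖ ^ 2) :=
          intervalIntegral.norm_integral_le_of_norm_le zero_le_one
            (ae_of_all _ fun x hx => hpt x (Ioc_subset_Icc_self hx)) i1
      _ = (1 + 1 / t n) * e n + t n * ∫ x in (0:ℝ)..1, ‖g' x‖ ^ 2 := by
          rw [intervalIntegral.integral_add ((hei n).const_mul _) (hg.intervalIntegrable_sq.const_mul _),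
            intervalIntegral.integral_const_mul, intervalIntegral.integral_const_mul, he_def]
      _ ≤ e n + Real.sqrt (e n) + t n * ∫ x in (0:ℝ)..1, ‖g' x‖ ^ 2 := by
          have hq : 1 / t n * e n ≤ Real.sqrt (e n) := by
            rw [one_div, inv_mul_le_iff₀ (ht0 n)]
            calc e n = Real.sqrt (e n) * Real.sqrt (e n) := (Real.mul_self_sqrt (he0 n)).symm
              _ ≤ t n * Real.sqrt (e n) := by
                  refine mul_le_mul_of_nonneg_right ?_ (Real.sqrt_nonneg _)
                  rw [ht_def]; exact le_add_of_nonneg_right (by positivity)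
          nlinarith [hq]
  have L2 : Tendsto (fun n => ∫ x in (0:ℝ)..1, h n x * conj (G n x)) atTop
      (𝓝 (∫ x in (0:ℝ)..1, g' x * conj (g x))) :=
    tendsto_intervalIntegral_mul_conj hhi hg'i hGc hgc (fun n => (hd_def n).symm.le) hd_t hGg hd_t hB
  have L2' : Tendsto (fun n => ∫ x in (0:ℝ)..1, G n x * conj (h n x)) atTop
      (𝓝 (∫ x in (0:ℝ)..1, g x * conj (g' x))) := by
    have e1 : ∀ (u v : ℝ → ℂ), (∫ x in (0:ℝ)..1, u x * conj (v x)) = conj (∫ x in (0:ℝ)..1, v x * conj (u x)) :=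
      fun u v => integral_mul_conj_eq_conj_swap u v
    simp only [e1 (G _) (h _), e1 g g']
    exact (Complex.continuous_conj.tendsto _).comp L2
  have L3 : Tendsto (fun n => ∫ x in (0:ℝ)..1, ‖G n x‖ ^ 2) atTop (𝓝 (∫ x in (0:ℝ)..1, ‖g x‖ ^ 2)) := by
    have L3c := tendsto_intervalIntegral_mul_conj hGi hgi hGc hgc hGg1 hd_t hGg hd_t hB
    have := (Complex.continuous_re.tendsto _).comp L3c
    simpa [Function.comp_def, integral_mul_conj_eq_ofReal] using this
  have L4 : Tendsto (fun n => ∫ x in (0:ℝ)..1, G n x * conj (∫ t in (0:ℝ)..x, G n t)) atTop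
      (𝓝 (∫ x in (0:ℝ)..1, g x * conj (∫ t in (0:ℝ)..x, g t))) :=
    tendsto_intervalIntegral_mul_conj hGi hgi hSnc hSc hGg1 hd_t hSnS hd_t hSB
  have L5 : Tendsto (fun n => ∫ x in (0:ℝ)..1, G n x) atTop (𝓝 (∫ x in (0:ℝ)..1, g x)) :=
    tendsto_intervalIntegral_of_norm_sub_le hGi hgi hGg1 hd_t
  have L6 : Tendsto (fun n => G n 1) atTop (𝓝 (g 1)) := by
    rw [tendsto_iff_norm_sub_tendsto_zero]
    exact squeeze_zero (fun n => norm_nonneg _) (fun n => hGg n 1 h1) hd_t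
  have L7 : Tendsto (fun n => ‖G n 1‖ ^ 2) atTop (𝓝 (‖g 1‖ ^ 2)) := ((continuous_norm.pow 2).tendsto _).comp L6
  -- assembly: every term of `DictS` is continuous along the approximation
  have hlim : Tendsto (fun n => DictS R Wp c0 (G n) (h n)) atTop (𝓝 (DictS R Wp c0 g g')) := by
    simp only [DictS, SixMomentS, hG0]
    refine Tendsto.add (Tendsto.add (Tendsto.sub (Tendsto.sub (Tendsto.sub (Tendsto.add (Tendsto.sub
      (Tendsto.add ?_ ?_) ?_) ?_) ?_) ?_) ?_) ?_) ?_
    · exact L1.const_mul _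
    · exact ((Complex.continuous_im.tendsto _).comp (tendsto_const_nhds.mul L2)).const_mul _
    · exact ((Complex.continuous_im.tendsto _).comp (tendsto_const_nhds.mul L2')).const_mul _
    · exact L3.const_mul _
    · exact ((Complex.continuous_re.tendsto _).comp (tendsto_const_nhds.mul
        (tendsto_const_nhds.mul ((Complex.continuous_conj.tendsto _).comp L5)))).const_mul _
    · exact ((Complex.continuous_im.tendsto _).comp (tendsto_const_nhds.mul
        ((L5.mul ((Complex.continuous_conj.tendsto _).comp L5)).sub L4))).const_mul _
    · exact ((Complex.continuous_re.tendsto _).comp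
        ((tendsto_const_nhds.mul L6).mul ((Complex.continuous_conj.tendsto _).comp L5))).const_mul _
    · exact ((Complex.continuous_re.tendsto _).comp
        (tendsto_const_nhds.mul ((Complex.continuous_conj.tendsto _).comp L6))).const_mul _
    · exact tendsto_const_nhds.mul L7
  exact ge_of_tendsto' hlim fun n => hk _ _ (kinked_of_isC1 (hGC1 n) (hm n))

/-- **Kinked ⇒ `H¹` for the shift dictionary slot:** if `DictShift b ≥ 0` on kinked profiles then `Det.DictShiftPSD b`.
[cite: Zhang2022LandauSiegel, §4 (4.1); §2 (2.18)–(2.19)] -/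
theorem dictShiftPSD_of_kinked (hk : ∀ G H : ℝ → ℂ, KinkedProfile G H → 0 ≤ DictShift b G H) : DictShiftPSD b :=
  fun _ _ hg => dictS_nonneg_of_isH1_of_kinked _ _ _ hk hg

/-- **[K7] `H¹` interface form:** bridges for every jet datum (K2″) ⇒ `Det.DictShiftPSD b` for sign-admissible `b`
(Parts 2 and 3). [cite: Zhang2022LandauSiegel, §4 (4.1); Prop 7.1 p.44 with (7.2), (8.11)–(8.23); §18 (18.1)] -/
theorem dictShiftPSD_of_bridges (hb : SignAdmissible b)
    (hK2 : ∀ a₀ a₁ Ig : ℂ, ∃ E E' E'' : ℝ → ℂ,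
      ContinuousOn E (Icc 0 1) ∧ ContinuousOn E' (Icc 0 1) ∧ ContinuousOn E'' (Icc 0 1) ∧
      (∀ y ∈ Ioo (0:ℝ) 1, HasDerivWithinAt E (E' y) (Ioi y) y) ∧
      (∀ y ∈ Ioo (0:ℝ) 1, HasDerivWithinAt E' (E'' y) (Ioi y) y) ∧
      E 0 = 0 ∧ E' 0 = -a₁ ∧ E 1 = Ig ∧ E' 1 = -a₀ ∧
      (atomA0 b).re * bulkFormOn b 0 1 E E' E''
        = freeEndForm b Ig (-a₀) + freeEndForm b 0 (-conj a₁) + π * (crossJet b a₀ a₁ Ig).re) :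
    DictShiftPSD b :=
  dictShiftPSD_of_kinked fun _ _ hG => dictShift_nonneg_kinked_of_bridges hb hK2 hG

end Density

end Det

end Literature.NumberTheory.LFunctions.Zhang2022
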